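import Mathlib
import Literature.Analysis.FluidPDE.TaoCascadeODE
import HarnessLib

/-!
# `SubcriticalEnvelope.ForwardSourceTailEnvelopeKP` (stmt-NavierStokesRegularity-27130) — glue for the
structural line: an `S`-RESTRICTED weighted shell barrier gives the `S`-partial tail ceiling
(helper file, `--supports`)

The only structural plan of the TL-M2Break cluster (SOC's «kp-shell-barrier» for 27057, through which
27130 closes by `forwardSourceTailEnvelopeKP_of_forwardTailCeilingKP`) must produce, for a KP-proper
orthant table with parked pockets, a ceiling on the FORWARD-SOURCE tails `Σ_{k=n..N} Σ_{i∈S} ½X_{i,k}²`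
only — the total-energy barrier `ShellBarrierAt` is false there (α_SB).  The natural intermediate
object is a weighted per-shell bound for the modes of `S` alone.  This file records the geometric-series
step in that generality, free of any route predicate:

* `sTailCeiling_of_sShellBarrier` — if along a family `X` on a window one has
  `(1+ε₀)^{2θk}·½X_{i,k}(t)² ≤ B` for all `t`, all `i ∈ S` and all shells `k : ℕ` (`θ > 0`), then
  `Σ_{k=n..N} Σ_{i∈S} ½X_{i,k}(t)² ≤ (|S|·B/(1 − (1+ε₀)^{-2θ}))·(1+ε₀)^{-2θn}` for all `n ≤ N`
  (pure real analysis: per-shell bound times a geometric sum);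
* `sTailCeiling_of_sShellBarrier_solutions` — the same wrapped in the solution binders of the cruxes
  (every `ν > 0`, one-shell datum, honest `ν`-viscous solution on `[0,s]` non-negative on shells `≥ 1`,
  `B = D·Σ_j ½X₀_j²`), i.e. «S-shell barrier ⇒ the ceiling clause of `ForwardTailCeilingKP` for that
  `S`, `θ`, with `C = |S|·D/(1−(1+ε₀)^{-2θ})`».

HONEST FRAMING: elementary bookkeeping about Tao-type MODEL lattice families (rung TL-M2Break); no
crux is proved; nothing here is a statement about the Navier–Stokes equations.
-/

noncomputable section

-- the sub-problem namespace `NavierStokesRegularity.NavierStokesRegularity` is the tree's layout (D-0017)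
set_option linter.dupNamespace false

namespace Summit.NavierStokesRegularity.NavierStokesRegularity.Theorems

open Set
open Literature.Analysis.FluidPDE.TaoCascade

/-- **`S`-shell barrier ⇒ `S`-tail ceiling (pure form).**  A weighted per-shell bound
`(1+ε₀)^{2θk}·½X_{i,k}(t)² ≤ B` for the modes `i ∈ S` and all shells `k : ℕ` at a time `t` gives
`Σ_{k=n..N} Σ_{i∈S} ½X_{i,k}(t)² ≤ (|S|·B/(1−r))·(1+ε₀)^{-2θn}`, `r = (1+ε₀)^{-2θ}` (`ε₀, θ > 0`).
Geometric series. [this file] -/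
theorem sTailCeiling_of_sShellBarrier {ε₀ θ B : ℝ} (hε : 0 < ε₀) (hθ : 0 < θ)
    (S : Finset (Fin 4)) {X : Fin 4 → ℤ → ℝ → ℝ} {t : ℝ}
    (H : ∀ i ∈ S, ∀ k : ℕ, (1 + ε₀) ^ (2 * θ * (k : ℝ)) * ((1 / 2 : ℝ) * X i (k : ℤ) t ^ 2) ≤ B)
    (n N : ℕ) :
    ∑ k ∈ Finset.Icc n N, ∑ i ∈ S, (1 / 2 : ℝ) * X i (k : ℤ) t ^ 2 ≤
      (S.card * B / (1 - (1 + ε₀) ^ (-(2 * θ)))) * (1 + ε₀) ^ (-(2 * θ * (n : ℝ))) := by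
  have hb : (1 : ℝ) < 1 + ε₀ := by linarith
  have hb0 : (0 : ℝ) ≤ 1 + ε₀ := by linarith
  set r : ℝ := (1 + ε₀) ^ (-(2 * θ)) with hr_def
  have hr0 : 0 < r := Real.rpow_pos_of_pos (by linarith) _
  have hr1 : r < 1 := by
    have : (1 + ε₀) ^ (-(2 * θ)) < (1 + ε₀) ^ (0 : ℝ) :=
      Real.rpow_lt_rpow_of_exponent_lt hb (by linarith)
    simpa [hr_def] using this
  have h1r : 0 < 1 - r := by linarith
  -- `B ≥ 0` as soon as `S` is non-empty; if `S = ∅` everything is `0`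
  rcases S.eq_empty_or_nonempty with hS | hS
  · subst hS
    simp
  obtain ⟨i₀, hi₀⟩ := hS
  have hB : 0 ≤ B := le_trans (mul_nonneg (Real.rpow_nonneg hb0 _) (by positivity)) (H i₀ hi₀ 0)
  have hpow : ∀ k : ℕ, (1 + ε₀) ^ (2 * θ * (k : ℝ)) * r ^ k = 1 := by
    intro k
    rw [hr_def, ← Real.rpow_mul_natCast hb0, ← Real.rpow_add (by linarith)]
    have : 2 * θ * (k : ℝ) + -(2 * θ) * (k : ℝ) = 0 := by ring
    rw [this, Real.rpow_zero]
  have hshell : ∀ k : ℕ, ∑ i ∈ S, (1 / 2 : ℝ) * X i (k : ℤ) t ^ 2 ≤ S.card * B * r ^ k := by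
    intro k
    have hk : ∀ i ∈ S, (1 / 2 : ℝ) * X i (k : ℤ) t ^ 2 ≤ B * r ^ k := by
      intro i hi
      have hrk : 0 < r ^ k := pow_pos hr0 k
      have := mul_le_mul_of_nonneg_right (H i hi k) hrk.le
      calc (1 / 2 : ℝ) * X i (k : ℤ) t ^ 2
          = ((1 + ε₀) ^ (2 * θ * (k : ℝ)) * r ^ k) * ((1 / 2 : ℝ) * X i (k : ℤ) t ^ 2) := by
            rw [hpow k, one_mul]
        _ = (1 + ε₀) ^ (2 * θ * (k : ℝ)) * ((1 / 2 : ℝ) * X i (k : ℤ) t ^ 2) * r ^ k := by ring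
        _ ≤ B * r ^ k := this
    calc ∑ i ∈ S, (1 / 2 : ℝ) * X i (k : ℤ) t ^ 2
        ≤ ∑ _i ∈ S, B * r ^ k := Finset.sum_le_sum hk
      _ = S.card * B * r ^ k := by rw [Finset.sum_const, nsmul_eq_mul]; ring
  have hgeom : ∑ k ∈ Finset.Icc n N, r ^ k ≤ r ^ n / (1 - r) := by
    rw [← Finset.Ico_add_one_right_eq_Icc]
    exact geom_sum_Ico_le_of_lt_one hr0.le hr1
  have hrn : r ^ n = (1 + ε₀) ^ (-(2 * θ * (n : ℝ))) := by
    rw [hr_def, ← Real.rpow_mul_natCast hb0]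
    congr 1; ring
  calc ∑ k ∈ Finset.Icc n N, ∑ i ∈ S, (1 / 2 : ℝ) * X i (k : ℤ) t ^ 2
      ≤ ∑ k ∈ Finset.Icc n N, S.card * B * r ^ k := Finset.sum_le_sum fun k _ => hshell k
    _ = S.card * B * ∑ k ∈ Finset.Icc n N, r ^ k := by rw [Finset.mul_sum (s := Finset.Icc n N)]
    _ ≤ S.card * B * (r ^ n / (1 - r)) :=
        mul_le_mul_of_nonneg_left hgeom (by positivity)
    _ = S.card * B / (1 - r) * (1 + ε₀) ^ (-(2 * θ * (n : ℝ))) := by rw [← hrn]; field_simp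

/-- **`S`-shell barrier ⇒ the ceiling clause of the KP cruxes, for a given mode set.**  If at scale
ratio `1+ε₀` a table `α` admits `θ > 0`, `D ≥ 0` such that along EVERY honest `ν`-viscous solution
from a one-shell datum `X₀` that is non-negative on shells `≥ 1` the modes of `S` obey
`(1+ε₀)^{2θk}·½X_{i,k}(t)² ≤ D·Σ_j ½X₀_j²` (all `t ∈ [0,s]`, `i ∈ S`, `k : ℕ`), then the `S`-partial
tails obey the ceiling `Σ_{k=n..N} Σ_{i∈S} ½X_{i,k}(t)² ≤ C·Σ_j ½X₀_j²·(1+ε₀)^{-2θn}` with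
`C = |S|·D/(1−(1+ε₀)^{-2θ})`, uniformly in `ν` — the shape consumed by `ForwardTailCeilingKP` (27057)
and hence by 27130 through the «via-ceiling» glue.  MODEL lattice bookkeeping. [this file] -/
theorem sTailCeiling_of_sShellBarrier_solutions {ε₀ θ D : ℝ} (hε : 0 < ε₀) (hθ : 0 < θ) (hD : 0 ≤ D)
    {α : Fin 4 → Fin 4 → Fin 4 → ℤ × ℤ × ℤ → ℝ} (S : Finset (Fin 4))
    (H : ∀ ν : ℝ, 0 < ν → ∀ (X₀ : Fin 4 → ℝ) (s : ℝ), 0 < s → ∀ X : Fin 4 → ℤ → ℝ → ℝ,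
      (∀ (i : Fin 4) (k : ℤ), X i k 0 = if k = 0 then X₀ i else 0) →
      (∀ (i : Fin 4) (k : ℤ), k < 0 → ∀ t : ℝ, X i k t = 0) →
      (∃ M : ℝ, ∀ (t : ℝ) (i : Fin 4) (k : ℤ), (1 + (1 + ε₀) ^ ((10 : ℝ) * k)) * |X i k t| ≤ M) →
      (∀ (i : Fin 4) (k : ℤ), Continuous (X i k)) →
      (∀ (i : Fin 4) (k : ℤ), ∀ t ∈ Icc (0 : ℝ) s, HasDerivWithinAt (X i k)
        (quadTerm ε₀ α X i k t - ν * (1 + ε₀) ^ ((2 : ℝ) * k) * X i k t) (Icc (0 : ℝ) s) t) →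
      (∀ t ∈ Icc (0 : ℝ) s, ∀ (i : Fin 4) (k : ℤ), 1 ≤ k → 0 ≤ X i k t) →
      ∀ t ∈ Icc (0 : ℝ) s, ∀ i ∈ S, ∀ k : ℕ,
        (1 + ε₀) ^ (2 * θ * (k : ℝ)) * ((1 / 2 : ℝ) * X i (k : ℤ) t ^ 2) ≤
          D * (∑ j : Fin 4, (1 / 2 : ℝ) * X₀ j ^ 2)) :
    ∃ C : ℝ, 0 ≤ C ∧ ∀ ν : ℝ, 0 < ν → ∀ (X₀ : Fin 4 → ℝ) (s : ℝ), 0 < s →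
      ∀ X : Fin 4 → ℤ → ℝ → ℝ,
      (∀ (i : Fin 4) (k : ℤ), X i k 0 = if k = 0 then X₀ i else 0) →
      (∀ (i : Fin 4) (k : ℤ), k < 0 → ∀ t : ℝ, X i k t = 0) →
      (∃ M : ℝ, ∀ (t : ℝ) (i : Fin 4) (k : ℤ), (1 + (1 + ε₀) ^ ((10 : ℝ) * k)) * |X i k t| ≤ M) →
      (∀ (i : Fin 4) (k : ℤ), Continuous (X i k)) →
      (∀ (i : Fin 4) (k : ℤ), ∀ t ∈ Icc (0 : ℝ) s, HasDerivWithinAt (X i k)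
        (quadTerm ε₀ α X i k t - ν * (1 + ε₀) ^ ((2 : ℝ) * k) * X i k t) (Icc (0 : ℝ) s) t) →
      (∀ t ∈ Icc (0 : ℝ) s, ∀ (i : Fin 4) (k : ℤ), 1 ≤ k → 0 ≤ X i k t) →
      ∀ n N : ℕ, n ≤ N → ∀ t ∈ Icc (0 : ℝ) s,
        ∑ k ∈ Finset.Icc n N, ∑ i ∈ S, (1 / 2 : ℝ) * X i (k : ℤ) t ^ 2 ≤
          C * (∑ j : Fin 4, (1 / 2 : ℝ) * X₀ j ^ 2) * (1 + ε₀) ^ (-(2 * θ * (n : ℝ))) := by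
  have hb : (1 : ℝ) < 1 + ε₀ := by linarith
  have hr1 : (1 + ε₀) ^ (-(2 * θ)) < 1 := by
    have : (1 + ε₀) ^ (-(2 * θ)) < (1 + ε₀) ^ (0 : ℝ) :=
      Real.rpow_lt_rpow_of_exponent_lt hb (by linarith)
    simpa using this
  refine ⟨S.card * D / (1 - (1 + ε₀) ^ (-(2 * θ))), by
    have : 0 < 1 - (1 + ε₀) ^ (-(2 * θ)) := by linarith
    positivity, ?_⟩
  intro ν hν X₀ s hs X hinit hlow hbd hcont hder hpos n N _hnN t ht
  have h := sTailCeiling_of_sShellBarrier hε hθ S (X := X) (t := t)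
    (B := D * (∑ j : Fin 4, (1 / 2 : ℝ) * X₀ j ^ 2))
    (fun i hi k => H ν hν X₀ s hs X hinit hlow hbd hcont hder hpos t ht i hi k) n N
  calc ∑ k ∈ Finset.Icc n N, ∑ i ∈ S, (1 / 2 : ℝ) * X i (k : ℤ) t ^ 2
      ≤ (S.card * (D * (∑ j : Fin 4, (1 / 2 : ℝ) * X₀ j ^ 2)) / (1 - (1 + ε₀) ^ (-(2 * θ)))) *
          (1 + ε₀) ^ (-(2 * θ * (n : ℝ))) := h
    _ = S.card * D / (1 - (1 + ε₀) ^ (-(2 * θ))) * (∑ j : Fin 4, (1 / 2 : ℝ) * X₀ j ^ 2) *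
          (1 + ε₀) ^ (-(2 * θ * (n : ℝ))) := by ring

end Summit.NavierStokesRegularity.NavierStokesRegularity.Theorems

end
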